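/-
Copyright (c) 2026. All rights reserved.
Released under Apache 2.0 license as described in the file LICENSE.
Authors: HodgeCM publication cell (pub-hodgecm), GR lane, seat GR-1 (`pub-hodgecm-own-real34`).
-/
import Literature.NumberTheory.GelbartRogawski1991.DoubledUnitaryArchSiegelRealSign
import Literature.NumberTheory.GelbartRogawski1991.QuadExtArchRealDetSign
import Literature.NumberTheory.Automorphic.UnitaryGroupArchSiegelLeviCayley
import Literature.NumberTheory.Automorphic.UnitaryGroupArchSignPatterns
import HarnessLib

/-!
# The Levi sign representatives of the archimedean Siegel parabolic of the doubled unitary group and their sign characters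

Topic `NumberTheory/GelbartRogawski1991`; namespace `Literature.NumberTheory.GelbartRogawski1991.GRConstructionGen`
(telescope of `DoubledUnitaryGlobalSplittingDataGen`).  KERNEL only: proved theorems (existential over the Cayley–Levi
homomorphism; no new definition), no named fact, no `sorry`.

For `E/F` quadratic with involution `c` and the doubled hermitian data `J^𝔻 = hermD` the real places of `E` come in pairs
`{w_k, c⁻¹ w_k}` over the real places of `F` split in `E` (type (ii)); enumerate them by `eκ : κ ⊕ κ ≃ {w real}`,
`eκ (inl k) = w_k`, `eκ (inr k) = c⁻¹ w_k`.  Fix `ε ∈ GL_n(ℝ)` with `det ε < 0`.  The Cayley–Levi homomorphism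
`mA : GL_n(E ⊗ ℝ) →* P_Δ(F ⊗ ℝ) ≤ U(J^𝔻)(F ⊗ ℝ)` (`UnitaryGroupArchSiegelLeviCayley`) applied to the sign patterns
(`UnitaryGroupArchSignPatterns`)

* `single k = signPatternGL (mulSingle w_k ε)` and `pair k = signPatternGL (mulSingle w_k ε · mulSingle (c⁻¹w_k) ε)`

gives the SINGLE and PAIR sign representatives `q₁ k := mA (single k)`, `q₀ k := mA (pair k)` of `P_Δ(F ⊗ ℝ)` modulo squares.
This file packages (**`exists_signReps`**) the homomorphism with: `(mA r, 1) ∈ P_Δ(𝔸)`, the action on `Δ`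
(`archMat (deltaBlock (mA r, 1)) = r`), the determinant at a real place `det (mA r)_w · det ρ(c⁻¹w) = det ρ(w)` for
`r = signPatternGL ρ` (from `DoubledUnitaryArchSiegelRealSign.det_evalR_mul_det_deltaBlock_eq`), and hence the values of the
sign characters `s_j = detSignAtR w_j` (`QuadExtArchRealDetSign`): **`s_j (q₁ k) = −1` iff `j = k`, else `1`; `s_j (q₀ k) = 1`**
— the binders `hs₀`, `hs₁`, `hs₁'` (and `hs2`, `hsc`) of `DoubledWeilRepresentationArchLiftSigns.exists_isArchHalf_twist_prod_signs`.

([Kudla1994, §3], case `E_v = F_v ⊕ F_v`; [HarrisKudlaSweet1996, §1 (1.11)–(1.12)]; [Adams2007, §5 Rem. 5.6]; archimedean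
places of type (ii) of [GelbartRogawski1991, Prop. 3.1.1].)  Written for the stage-1 cell `pub-hodgecm` (seat GR-1);
nothing here is a claim of the manuscripts adjudicated by that cell.

## References

* S. S. Kudla, Israel J. Math. 87 (1994) 361–401, §3 [Kudla1994].
* M. Harris, S. S. Kudla, W. J. Sweet, J. Amer. Math. Soc. 9 (1996), §1 (1.11)–(1.12) [HarrisKudlaSweet1996].
* J. Adams, *The theta correspondence over ℝ* (2007), §5 Rem. 5.6 [Adams2007].
* S. Gelbart, J. Rogawski, Invent. Math. 105 (1991), §3.1 Prop. 3.1.1 p. 455 [GelbartRogawski1991].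
-/

set_option autoImplicit false

noncomputable section

open scoped Classical
open scoped Matrix MatrixGroups
open NumberField NumberField.InfinitePlace NumberField.mixedEmbedding IsDedekindDomain
open Literature.NumberTheory.Automorphic Literature.NumberTheory.Automorphic.UnitaryGroup
open Literature.NumberTheory.Weil1964
open Literature.NumberTheory.GaloisRepresentations
open Literature.RepresentationTheory.HeisenbergGroup
open Literature.NumberTheory.GelbartRogawski1991.UnitaryDualPair.ArchSplitting.QuadExt

namespace Literature.NumberTheory.GelbartRogawski1991.GRConstructionGen

open UnitaryDualPair

variable (F : Type) [Field F] [NumberField F] (E : Type) [Field E] [NumberField E] [Algebra F E]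
  [Algebra.IsQuadraticExtension F E]
variable (c : E ≃ₐ[F] E) {δ : E} (hcδ : c δ = -δ) (hδ : δ ≠ 0) {d : F} (hd : δ * δ = algebraMap F E d)
variable {N M n : ℕ} (e : Fin N × Fin M ≃ Fin n)
  (TV : Matrix (Fin N) (Fin N) F) (hV : TV.IsSymm) (hVd : IsUnit TV.det)
  (TW : Matrix (Fin M) (Fin M) F) (hW : TW.IsSymm) (hWd : IsUnit TW.det)

/-! ## §1 The Cayley–Levi homomorphism at the doubled data; determinants at the real places -/

omit [Algebra.IsQuadraticExtension F E] in
include hV hW hVd hWd in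
/-- **the Cayley–Levi homomorphism `mA : GL_n(E ⊗ ℝ) →* U(J^𝔻)(F ⊗ ℝ)` at the doubled data**: `(mA r, 1) ∈ P_Δ(𝔸)` and
`archMat (deltaBlock (mA r, 1)) = r` (the action on `Δ ⊗ ℝ`). [cite: HarrisKudlaSweet1996, §1 (1.11)–(1.12)] -/
theorem exists_leviCayleyD (hc : ∀ x, c (c x) = x) :
    ∃ mA : GL (Fin n) (mixedSpace E) →* arch F E c (n + n) (hermD F E e TV TW),
      (∀ r, IsSiegelDelta F E c e TV TW (UnitaryGroup.archToAdelic F E c (n + n) (hermD F E e TV TW) (mA r))) ∧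
      (∀ r, archMat E (Fin n) (deltaBlock F E c e TV TW (UnitaryGroup.archToAdelic F E c (n + n) (hermD F E e TV TW) (mA r))) =
        ((r : GL (Fin n) (mixedSpace E)) : Matrix (Fin n) (Fin n) (mixedSpace E))) := by
  have hTs : (gramR F e TV TW)ᵀ = gramR F e TV TW := by
    have hT : (gramR F e TV TW).IsSymm := by
      show (Matrix.reindex e e _).IsSymm
      exact (UnitaryGroup.isSymm_kronecker hV hW).submatrix _
    exact hT.eq
  have hTu : IsUnit (gramR F e TV TW).det := isUnit_det_gram F e hVd hWd
  have hJ : hermD F E e TV TW =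
      (Matrix.reindex (e₂ (n := n)) (e₂ (n := n)) (Matrix.fromBlocks (gramR F e TV TW) 0 0 (-gramR F e TV TW))).map
        (algebraMap F E) := rfl
  obtain ⟨mA, hP, -, hΔ⟩ := exists_leviCayleyHom_arch_of_base F E c (n + n) (hermD F E e TV TW) (e₂ (n := n)) hc hTs hTu hJ
  refine ⟨mA, fun r => hP r, fun r => ?_⟩
  rw [archMat_deltaBlock_archToAdelic]
  exact hΔ r

omit [Algebra.IsQuadraticExtension F E] in
include hVd hWd in
/-- **`det (mA r)_w · det ρ(c⁻¹ w) = det ρ(w)`** at a real place `w` of `E`, for the Cayley–Levi element of a sign pattern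
`r = signPatternGL ρ` (the determinant identity of the Siegel parabolic read at `w`, `α = r`).
[cite: Kudla1994, §3] [cite: HarrisKudlaSweet1996, §1 (1.11)–(1.12)] -/
theorem det_evalR_leviCayley_signPattern (hcc : c * c = 1)
    (mA : GL (Fin n) (mixedSpace E) →* arch F E c (n + n) (hermD F E e TV TW))
    (hP : ∀ r, IsSiegelDelta F E c e TV TW (UnitaryGroup.archToAdelic F E c (n + n) (hermD F E e TV TW) (mA r)))
    (hΔ : ∀ r, archMat E (Fin n) (deltaBlock F E c e TV TW (UnitaryGroup.archToAdelic F E c (n + n) (hermD F E e TV TW) (mA r))) =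
      ((r : GL (Fin n) (mixedSpace E)) : Matrix (Fin n) (Fin n) (mixedSpace E)))
    (ρ : {w : InfinitePlace E // w.IsReal} → GL (Fin n) ℝ) (w : {w : InfinitePlace E // w.IsReal}) :
    ((((mA (signPatternGL E ρ) : arch F E c (n + n) (hermD F E e TV TW)) : GL (Fin (n + n)) (mixedSpace E)) :
          Matrix (Fin (n + n)) (Fin (n + n)) (mixedSpace E)).map (evalR E w)).det *
        ((ρ ⟨c⁻¹ • w.1, isReal_smul_iff.mpr w.2⟩ : GL (Fin n) ℝ) : Matrix (Fin n) (Fin n) ℝ).det =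
      ((ρ w : GL (Fin n) ℝ) : Matrix (Fin n) (Fin n) ℝ).det := by
  have key := det_evalR_mul_det_deltaBlock_eq F E c e TV hVd TW hWd hcc (mA (signPatternGL E ρ)) (hP _) w
  have hx : ∀ w' : {w : InfinitePlace E // w.IsReal},
      (archMat E (Fin n) (deltaBlock F E c e TV TW
        (UnitaryGroup.archToAdelic F E c (n + n) (hermD F E e TV TW) (mA (signPatternGL E ρ))))).det.1 w' =
        ((ρ w' : GL (Fin n) ℝ) : Matrix (Fin n) (Fin n) ℝ).det := by
    intro w'
    rw [hΔ, ← evalR_apply, RingHom.map_det, RingHom.mapMatrix_apply, coe_signPatternGL, map_evalR_signPatternMat]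
  rwa [hx, hx] at key

/-! ## §2 The single and pair representatives and the values of the sign characters -/

section Reps

variable {κ : Type*} (wOf : κ → {w : InfinitePlace E // w.IsReal}) (eκ : κ ⊕ κ ≃ {w : InfinitePlace E // w.IsReal})
  (he₁ : ∀ k, eκ (Sum.inl k) = wOf k) (he₂ : ∀ k, eκ (Sum.inr k) = ⟨c⁻¹ • (wOf k).1, isReal_smul_iff.mpr (wOf k).2⟩)

omit [NumberField F] [NumberField E] [Algebra.IsQuadraticExtension F E] in
include he₁ in
/-- `wOf` is injective. [cite: Kudla1994, §3] -/
theorem wOf_injective : Function.Injective wOf := fun j k h =>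
  Sum.inl_injective (eκ.injective (by rw [he₁, he₁, h]))

omit [NumberField F] [NumberField E] [Algebra.IsQuadraticExtension F E] in
include he₁ he₂ in
/-- `c⁻¹ w_j ≠ w_k`. [cite: Kudla1994, §3] -/
theorem smul_wOf_ne (j k : κ) : (⟨c⁻¹ • (wOf j).1, isReal_smul_iff.mpr (wOf j).2⟩ : {w : InfinitePlace E // w.IsReal}) ≠ wOf k := by
  intro h
  have h1 : eκ (Sum.inr j) = eκ (Sum.inl k) := by rw [he₂, he₁, h]
  exact Sum.inr_ne_inl (eκ.injective h1)

omit [NumberField F] [NumberField E] [Algebra.IsQuadraticExtension F E] in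
include he₂ in
/-- `c⁻¹ w_j = c⁻¹ w_k ↔ j = k`. [cite: Kudla1994, §3] -/
theorem smul_wOf_eq_iff (j k : κ) :
    (⟨c⁻¹ • (wOf j).1, isReal_smul_iff.mpr (wOf j).2⟩ : {w : InfinitePlace E // w.IsReal}) =
      ⟨c⁻¹ • (wOf k).1, isReal_smul_iff.mpr (wOf k).2⟩ ↔ j = k := by
  refine ⟨fun h => Sum.inr_injective (eκ.injective (by rw [he₂, he₂, h])), fun h => by rw [h]⟩

omit [NumberField F] [NumberField E] [Algebra.IsQuadraticExtension F E] in
include he₁ he₂ in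
/-- the SINGLE pattern `mulSingle w_k ε` at `w_j` and at `c⁻¹ w_j`. [cite: Kudla1994, §3] -/
theorem single_apply (ε : GL (Fin n) ℝ) (j k : κ) :
    (Pi.mulSingle (wOf k) ε : {w : InfinitePlace E // w.IsReal} → GL (Fin n) ℝ) (wOf j) = (if j = k then ε else 1) ∧
      (Pi.mulSingle (wOf k) ε : {w : InfinitePlace E // w.IsReal} → GL (Fin n) ℝ)
        ⟨c⁻¹ • (wOf j).1, isReal_smul_iff.mpr (wOf j).2⟩ = 1 := by
  refine ⟨?_, ?_⟩
  · rw [Pi.mulSingle_apply]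
    by_cases h : j = k
    · rw [if_pos (congrArg wOf h), if_pos h]
    · rw [if_neg (fun h' => h (wOf_injective E wOf eκ he₁ h')), if_neg h]
  · rw [Pi.mulSingle_apply, if_neg (smul_wOf_ne F E c wOf eκ he₁ he₂ j k)]

omit [NumberField F] [NumberField E] [Algebra.IsQuadraticExtension F E] in
include he₁ he₂ in
/-- the PAIR pattern `mulSingle w_k ε · mulSingle (c⁻¹w_k) ε` at `w_j` and at `c⁻¹ w_j`: both `ε` if `j = k`, both `1` else.
[cite: Kudla1994, §3] -/
theorem pair_apply (ε : GL (Fin n) ℝ) (j k : κ) :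
    (Pi.mulSingle (wOf k) ε * Pi.mulSingle (⟨c⁻¹ • (wOf k).1, isReal_smul_iff.mpr (wOf k).2⟩ : {w : InfinitePlace E // w.IsReal}) ε :
        {w : InfinitePlace E // w.IsReal} → GL (Fin n) ℝ) (wOf j) = (if j = k then ε else 1) ∧
      (Pi.mulSingle (wOf k) ε * Pi.mulSingle (⟨c⁻¹ • (wOf k).1, isReal_smul_iff.mpr (wOf k).2⟩ : {w : InfinitePlace E // w.IsReal}) ε :
        {w : InfinitePlace E // w.IsReal} → GL (Fin n) ℝ) ⟨c⁻¹ • (wOf j).1, isReal_smul_iff.mpr (wOf j).2⟩ =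
        (if j = k then ε else 1) := by
  obtain ⟨h1, h2⟩ := single_apply F E c wOf eκ he₁ he₂ ε j k
  refine ⟨?_, ?_⟩
  · rw [Pi.mul_apply, h1, Pi.mulSingle_apply, if_neg (Ne.symm (smul_wOf_ne F E c wOf eκ he₁ he₂ k j)), mul_one]
  · rw [Pi.mul_apply, h2, one_mul, Pi.mulSingle_apply]
    by_cases h : j = k
    · rw [if_pos ((smul_wOf_eq_iff F E c wOf eκ he₂ j k).2 h), if_pos h]
    · rw [if_neg (fun h' => h ((smul_wOf_eq_iff F E c wOf eκ he₂ j k).1 h')), if_neg h]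

omit [Algebra.IsQuadraticExtension F E] in
include hV hW hVd hWd he₁ he₂ in
/-- **THE SIGN REPRESENTATIVES AND THEIR SIGN CHARACTERS.**  With `mA` the Cayley–Levi homomorphism at the doubled data,
`q₁ k := mA (signPatternGL (mulSingle w_k ε))` (single) and `q₀ k := mA (signPatternGL (mulSingle w_k ε · mulSingle (c⁻¹w_k) ε))`
(pair), `det ε < 0`, and the sign characters `s_j := detSignAtR w_j`: all `q₀ k`, `q₁ k` lie in `P_Δ`, `s_j (q₁ j) = −1`,
`s_j (q₁ k) = 1` for `j ≠ k`, `s_j (q₀ k) = 1`, `s_j² = 1`, `s_j` continuous — the binders `hq₁`, `hQ₀`, `hs₁'`, `hs₁`,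
`hs₀`, `hs2`, `hsc` of `DoubledWeilRepresentationArchLiftSigns.exists_isArchHalf_twist_prod_signs`; and the action of every
`mA r` on `Δ` is `r`. [cite: Kudla1994, §3] [cite: HarrisKudlaSweet1996, §1 (1.11)–(1.12)] [cite: Adams2007, §5 Rem. 5.6] -/
theorem exists_signReps (hc : ∀ x, c (c x) = x) (ε : GL (Fin n) ℝ) (hε : ((ε : GL (Fin n) ℝ) : Matrix (Fin n) (Fin n) ℝ).det < 0) :
    ∃ mA : GL (Fin n) (mixedSpace E) →* arch F E c (n + n) (hermD F E e TV TW),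
      (∀ r, IsSiegelDelta F E c e TV TW (UnitaryGroup.archToAdelic F E c (n + n) (hermD F E e TV TW) (mA r))) ∧
      (∀ r, archMat E (Fin n) (deltaBlock F E c e TV TW (UnitaryGroup.archToAdelic F E c (n + n) (hermD F E e TV TW) (mA r))) =
        ((r : GL (Fin n) (mixedSpace E)) : Matrix (Fin n) (Fin n) (mixedSpace E))) ∧
      (∀ j k, j ≠ k → detSignAtR F E c (hermD F E e TV TW) (wOf j) (mA (signPatternGL E (Pi.mulSingle (wOf k) ε))) = 1) ∧
      (∀ j, ((detSignAtR F E c (hermD F E e TV TW) (wOf j) (mA (signPatternGL E (Pi.mulSingle (wOf j) ε))) : ℂˣ) : ℂ) = -1) ∧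
      (∀ j k, detSignAtR F E c (hermD F E e TV TW) (wOf j)
        (mA (signPatternGL E (Pi.mulSingle (wOf k) ε *
          Pi.mulSingle (⟨c⁻¹ • (wOf k).1, isReal_smul_iff.mpr (wOf k).2⟩ : {w : InfinitePlace E // w.IsReal}) ε))) = 1) := by
  have hcc : c * c = 1 := AlgEquiv.ext fun y => by rw [AlgEquiv.mul_apply, hc]; rfl
  obtain ⟨mA, hP, hΔ⟩ := exists_leviCayleyD F E c e TV hV hVd TW hW hWd hc
  have hdet := det_evalR_leviCayley_signPattern F E c e TV hVd TW hWd hcc mA hP hΔ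
  refine ⟨mA, hP, hΔ, fun j k hjk => ?_, fun j => ?_, fun j k => ?_⟩
  · -- single `k` at `w_j`, `j ≠ k`: `det = 1 / 1`
    have h := hdet (Pi.mulSingle (wOf k) ε) (wOf j)
    obtain ⟨h1, h2⟩ := single_apply F E c wOf eκ he₁ he₂ ε j k
    rw [h1, h2, if_neg hjk, Units.val_one, Matrix.det_one, mul_one] at h
    exact Units.ext ((coe_detSignAtR_of_pos F E c _ (wOf j) _ (by rw [h]; exact one_pos)).trans Units.val_one.symm)
  · -- single `j` at `w_j`: `det = det ε / 1 < 0`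
    have h := hdet (Pi.mulSingle (wOf j) ε) (wOf j)
    obtain ⟨h1, h2⟩ := single_apply F E c wOf eκ he₁ he₂ ε j j
    rw [h1, h2, if_pos rfl, Units.val_one, Matrix.det_one, mul_one] at h
    exact coe_detSignAtR_of_neg F E c _ (wOf j) _ (by rw [h]; exact hε)
  · -- pair `k` at `w_j`: `det = det ε / det ε` or `1 / 1`
    have h := hdet (Pi.mulSingle (wOf k) ε *
      Pi.mulSingle (⟨c⁻¹ • (wOf k).1, isReal_smul_iff.mpr (wOf k).2⟩ : {w : InfinitePlace E // w.IsReal}) ε) (wOf j)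
    obtain ⟨h1, h2⟩ := pair_apply F E c wOf eκ he₁ he₂ ε j k
    rw [h1, h2] at h
    have hpos : 0 < ((((mA (signPatternGL E (Pi.mulSingle (wOf k) ε *
        Pi.mulSingle (⟨c⁻¹ • (wOf k).1, isReal_smul_iff.mpr (wOf k).2⟩ : {w : InfinitePlace E // w.IsReal}) ε)) :
          arch F E c (n + n) (hermD F E e TV TW)) : GL (Fin (n + n)) (mixedSpace E)) :
          Matrix (Fin (n + n)) (Fin (n + n)) (mixedSpace E)).map (evalR E (wOf j))).det := by
      by_cases hjk : j = k
      · rw [if_pos hjk] at h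
        -- `a · det ε = det ε`, `det ε ≠ 0` ⇒ `a = 1`
        have ha := mul_right_cancel₀ hε.ne (h.trans (one_mul _).symm)
        rw [ha]; exact one_pos
      · rw [if_neg hjk, Units.val_one, Matrix.det_one, mul_one] at h
        rw [h]; exact one_pos
    exact Units.ext ((coe_detSignAtR_of_pos F E c _ (wOf j) _ hpos).trans Units.val_one.symm)

end Reps

end Literature.NumberTheory.GelbartRogawski1991.GRConstructionGen

end
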